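import Literature.MathematicalPhysics.KineticTheory.PureQuarticChainNESSProofs
import Literature.MathematicalPhysics.KineticTheory.LangevinSemigroupHarrisOne
import Literature.MathematicalPhysics.KineticTheory.PureQuarticChainMinorization
import HarnessLib

/-!
# Cuneo–Eckmann–Hairer–Rey-Bellet 2018, Theorem 2.13 for the purely quartic chain — the named fact `CuneoEckmannHairerReyBellet2018_thm213_pureQuartic` HOLDS

Topic `Literature/MathematicalPhysics/KineticTheory` (trunk T-KINETIC). Discharge of the named fact
`CuneoEckmannHairerReyBellet2018_thm213_pureQuartic` (`PureQuarticChainNESS.lean`):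
Cuneo–Eckmann–Hairer–Rey-Bellet, *Non-equilibrium steady states for networks of oscillators*,
Electron. J. Probab. **23** (2018) no. 55 (arXiv:1712.09413), Theorem 2.13 (1)–(3) for
`pureQuarticChain μ γ = ⟨U = μq⁴/4, V = r⁴/4, γ⟩`, `μ, γ > 0`, `N ≥ 1`, `T_L, T_R > 0`, assembled —
exactly as the printed Theorem 3.1 (Props. 3.2, 3.3, 3.6, 3.7, 3.8 with H1 = Prop. 4.1 and
H2 = Thm 5.1 / Rem 5.2) — from results PROVED in the tree for the transition semigroup
`S = (pureQuarticChain_isConfining hμ hγ.le).semigroup N T_L T_R …` of the SDE (2.2)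
(model-free pipeline, kernels `OscillatorChain.langevinKernel`):

* Feller property and the a-priori bound (3.4) (`PureQuarticChainConfined.lean`), continuity,
  nonnegativity and coercivity of `H` (`PureQuarticEnergy.lean`);
* **H2 at `t* = 1`** (`pureQuarticChain_H2`, `PureQuarticChainNESSProofs.lean`, CEHR Thm 5.1 /
  Rem 5.2), here put in the small-set form `P_1 e^{θH} ≤ κ e^{θH} + c 1_K` with `κ ∈ (0,1)`, `c > 0`,
  `K = {H ≤ E}` compact (`pureQuarticChain_langevinKernel_H2_one_indicator`: outside a large energy
  sublevel set the additive constant is absorbed by `((1-κ)/2) e^{θH}`);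
* **Prop. 3.6**, every compact set is small for all large times (`pureQuarticChain_minorization`,
  `PureQuarticChainMinorization.lean`);
* Props. 3.7–3.8 (Krylov–Bogoliubov; Harris' theorem of Hairer–Mattingly on the skeleton `P_m`)
  for a general `LangevinChainSemigroup` from H2 at time one (`LangevinSemigroupHarrisOne.lean`);
* the smooth density of every invariant probability measure — Prop. 3.2 with the bracket
  condition Prop. 4.1 for the coupling `r⁴/4` (non-degenerate of order `3`) and Hörmander's
  Theorem 1.1, proved in `Literature/Analysis/Hypoelliptic/HormanderProof.lean`
  (`pureQuarticChain_hasSmoothDensity_of_isInvariant`, `PureQuarticChainHormander.lean`).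

* `pureQuarticChain_langevin_semigroup_ergodic` — Thm 2.13 (2), (3) and uniqueness for `S`;
* `CuneoEckmannHairerReyBellet2018_thm213_pureQuartic_holds` — **the named fact holds**.

Everything is PROVED; no definition, no named fact.

## References

* N. Cuneo, J.-P. Eckmann, M. Hairer, L. Rey-Bellet, EJP **23** (2018) no. 55 (arXiv:1712.09413),
  Thm 2.13, Thm 3.1, §3 eq. (3.4), Props. 3.2–3.8, Prop. 4.1, Thm 5.1, Rem 5.2.
* M. Hairer, J. C. Mattingly, *Yet another look at Harris' ergodic theorem for Markov chains*,
  Progr. Probab. **63** (2011), Thm 1.2.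
* L. Hörmander, Acta Math. **119** (1967) 147–171, Thm 1.1.
-/

noncomputable section

open MeasureTheory ProbabilityTheory Filter Topology Set Metric
open scoped NNReal ENNReal

namespace Literature.MathematicalPhysics.KineticTheory.HeatConduction

open Literature.Probability.Process OscillatorChain

variable {N : ℕ}

section Holds

variable {μ γ : ℝ} (hμ : 0 < μ) (hγ : 0 < γ) (hN : 0 < N) {T_L T_R : ℝ} (hL : 0 < T_L)
  (hR : 0 < T_R)
include hμ hγ hN hL hR

/-- **H2 at `t* = 1` in small-set form** for the transition kernels `langevinKernel` of the purely
quartic chain: from `P_1 e^{θH} ≤ κ e^{θH} + c` (`κ ∈ [0,1)`, `c ≥ 0`, `pureQuarticChain_H2`) to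
`P_1 e^{θH} ≤ κ' e^{θH} + c' 1_K` with `κ' = (1+κ)/2 ∈ (0,1)`, `c' = c + 1 > 0` and the compact
energy sublevel set `K = {H ≤ E}`, `E = 2c/((1-κ)θ)`: off `K`, `c ≤ ((1-κ)/2) e^{θH}` because
`e^{θE} ≥ 1 + θE > 2c/(1-κ)`. [cite: CuneoEckmannHairerReyBellet2018, Thm 5.1 and Rem 5.2] -/
theorem pureQuarticChain_langevinKernel_H2_one_indicator {θ : ℝ} (hθ : 0 < θ)
    (hθ' : θ < 1 / max T_L T_R) :
    ∃ (κ c : ℝ) (K : Set (PhaseSpace N)), 0 < κ ∧ κ < 1 ∧ 0 < c ∧ IsCompact K ∧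
      ∀ z : PhaseSpace N,
        ∫⁻ y, ENNReal.ofReal (Real.exp (θ * (pureQuarticChain μ γ).hamiltonian N y))
            ∂((pureQuarticChain μ γ).langevinKernel N T_L T_R 1 z) ≤
          ENNReal.ofReal (κ * Real.exp (θ * (pureQuarticChain μ γ).hamiltonian N z) +
            c * K.indicator 1 z) := by
  obtain ⟨κ, c, hκ0, hκ1, hc0, hb⟩ := pureQuarticChain_H2 hμ hγ hN hL hR hθ hθ'
  set H := (pureQuarticChain μ γ).hamiltonian N with hH
  set E : ℝ := 2 * c / ((1 - κ) * θ) with hE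
  have h1κ : 0 < 1 - κ := by linarith
  refine ⟨(1 + κ) / 2, c + 1, {x | H x ≤ E}, by linarith, by linarith, by linarith,
    pureQuarticChain_isCompact_setOf_hamiltonian_le hμ γ N E, fun z => (hb z).trans ?_⟩
  refine ENNReal.ofReal_le_ofReal ?_
  have hV : 0 < Real.exp (θ * H z) := Real.exp_pos _
  by_cases hz : H z ≤ E
  · have hzK : z ∈ ({x | H x ≤ E} : Set (PhaseSpace N)) := hz
    rw [Set.indicator_of_mem hzK, Pi.one_apply, mul_one]
    nlinarith
  · have hzK : z ∉ ({x | H x ≤ E} : Set (PhaseSpace N)) := hz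
    rw [Set.indicator_of_notMem hzK, mul_zero, add_zero]
    have hEz : E < H z := lt_of_not_ge hz
    -- `e^{θH(z)} ≥ e^{θE} ≥ 1 + θE = 1 + 2c/(1-κ)`
    have hexp : 1 + θ * E ≤ Real.exp (θ * H z) := by
      calc 1 + θ * E ≤ θ * E + 1 := by linarith
        _ ≤ Real.exp (θ * E) := Real.add_one_le_exp _
        _ ≤ Real.exp (θ * H z) := Real.exp_le_exp.2 (mul_le_mul_of_nonneg_left hEz.le hθ.le)
    have hθE : θ * E = 2 * c / (1 - κ) := by
      rw [hE]; field_simp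
    rw [hθE] at hexp
    -- `c ≤ ((1-κ)/2) e^{θH(z)}`
    have hc : c ≤ (1 - κ) / 2 * Real.exp (θ * H z) := by
      have h2 : 2 * c / (1 - κ) ≤ Real.exp (θ * H z) := by linarith
      rw [div_le_iff₀ h1κ] at h2
      nlinarith
    nlinarith

/-- **Theorem 2.13 (2), (3) and uniqueness for the transition semigroup `S` of the purely quartic
chain**: at most one invariant probability measure; an invariant probability measure `μ⋆`
integrating every `e^{ϑH}`, `0 < ϑ < 1/max(T_L, T_R)`; and the exponential convergence (2.5)
`|P_t f(z) - μ⋆(f)| ≤ C e^{ϑH(z)} e^{-ct}` for continuous `|f| ≤ e^{ϑH}`. Inputs: Feller and (3.4)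
(`PureQuarticChainConfined.lean`), H2 at time one (`pureQuarticChain_langevinKernel_H2_one_indicator`),
Prop. 3.6 (`pureQuarticChain_minorization`), Props. 3.7–3.8 (`LangevinSemigroupHarrisOne.lean`).
[cite: CuneoEckmannHairerReyBellet2018, Thm 2.13 and Thm 3.1] -/
theorem pureQuarticChain_langevin_semigroup_ergodic :
    (∀ m m' : Measure (PhaseSpace N), IsProbabilityMeasure m → IsProbabilityMeasure m' →
        ((pureQuarticChain_isConfining hμ hγ.le).semigroup N T_L T_R hN hL.le hR.le).IsInvariant m →
        ((pureQuarticChain_isConfining hμ hγ.le).semigroup N T_L T_R hN hL.le hR.le).IsInvariant m' →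
        m = m') ∧
    ∃ ms : Measure (PhaseSpace N), IsProbabilityMeasure ms ∧
      ((pureQuarticChain_isConfining hμ hγ.le).semigroup N T_L T_R hN hL.le hR.le).IsInvariant ms ∧
      ∀ ϑ : ℝ, 0 < ϑ → ϑ < 1 / max T_L T_R →
        Integrable (fun z => Real.exp (ϑ * (pureQuarticChain μ γ).hamiltonian N z)) ms ∧
        ∃ C c : ℝ, 0 < C ∧ 0 < c ∧
          ∀ (z : PhaseSpace N) (t : ℝ≥0) (f : PhaseSpace N → ℝ), Continuous f →
            (∀ y, |f y| ≤ Real.exp (ϑ * (pureQuarticChain μ γ).hamiltonian N y)) →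
            |((pureQuarticChain_isConfining hμ hγ.le).semigroup N T_L T_R hN hL.le hR.le).act t f z -
                ∫ y, f y ∂ms| ≤
              C * Real.exp (ϑ * (pureQuarticChain μ γ).hamiltonian N z) * Real.exp (-c * t) := by
  set S := (pureQuarticChain_isConfining hμ hγ.le).semigroup N T_L T_R hN hL.le hR.le with hS
  have hTm : 0 < 1 / max T_L T_R := by positivity
  -- the model-free inputs: Feller, continuity and coercivity of `H`, (3.4)
  have hF : ∀ (t : ℝ≥0) (g : BoundedContinuousFunction (PhaseSpace N) ℝ), Continuous (S.act t g) :=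
    pureQuarticChain_continuous_act_semigroup hμ hγ.le hN hL.le hR.le
  have hHc : Continuous ((pureQuarticChain μ γ).hamiltonian N) :=
    pureQuarticChain_continuous_hamiltonian μ γ N
  have hcpt : ∀ θ : ℝ, 0 < θ → ∀ R : ℝ≥0, IsCompact {x : PhaseSpace N |
      (Real.exp (θ * (pureQuarticChain μ γ).hamiltonian N x)).toNNReal ≤ R} := fun θ hθ R =>
    pureQuarticChain_isCompact_setOf_exp_le hμ γ N hθ R
  have hCstar : ∀ θ : ℝ, 0 < θ → 0 ≤ θ * γ * (T_L + T_R) := fun θ hθ => by positivity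
  have h34 : ∀ θ : ℝ, 0 < θ → θ < 1 / max T_L T_R → ∀ (t : ℝ≥0) (z : PhaseSpace N),
      ∫⁻ y, ENNReal.ofReal (Real.exp (θ * (pureQuarticChain μ γ).hamiltonian N y)) ∂(S.kernel t z) ≤
        ENNReal.ofReal (Real.exp (θ * γ * (T_L + T_R) * t) *
          Real.exp (θ * (pureQuarticChain μ γ).hamiltonian N z)) := fun θ hθ hθ' t z =>
    pureQuarticChain_lintegral_exp_mul_hamiltonian_kernel_le hμ hγ.le hN hL.le hR.le hL hθ hθ' t z
  -- H2 at time one and Prop. 3.6 for the kernels of `S`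
  have h2 : ∀ θ : ℝ, 0 < θ → θ < 1 / max T_L T_R →
      ∃ (κ c : ℝ) (K : Set (PhaseSpace N)), 0 < κ ∧ κ < 1 ∧ 0 < c ∧ IsCompact K ∧
        ∀ z : PhaseSpace N,
          ∫⁻ y, ENNReal.ofReal (Real.exp (θ * (pureQuarticChain μ γ).hamiltonian N y))
              ∂(S.kernel 1 z) ≤
            ENNReal.ofReal (κ * Real.exp (θ * (pureQuarticChain μ γ).hamiltonian N z) +
              c * K.indicator 1 z) := fun θ hθ hθ' =>
    pureQuarticChain_langevinKernel_H2_one_indicator hμ hγ hN hL hR hθ hθ'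
  have h36 : ∀ C : Set (PhaseSpace N), IsCompact C → ∃ t_C : ℝ≥0, ∀ t : ℝ≥0, t_C ≤ t →
      ∃ ν : Measure (PhaseSpace N), ν ≠ 0 ∧ ∀ z ∈ C, ν ≤ S.kernel t z :=
    pureQuarticChain_minorization hμ hγ hN hL T_R
  have hH0 : ∀ z, 0 ≤ (pureQuarticChain μ γ).hamiltonian N z :=
    pureQuarticChain_hamiltonian_nonneg hμ.le γ N
  obtain ⟨ms, hms, hinv, hint⟩ := S.exists_isInvariant_of_H2_one hF hHc hcpt hCstar h34 h2 hTm
  refine ⟨fun m m' hm hm' hmi hm'i => ?_, ms, hms, hinv, fun ϑ hϑ0 hϑ1 => ⟨hint ϑ hϑ0 hϑ1, ?_⟩⟩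
  · haveI := hm; haveI := hm'
    exact S.invariant_unique_of_H2_one_of_minorization hHc hcpt h2 hTm h36 m m' hmi hm'i
  · haveI := hms
    exact S.exp_convergence_of_H2_one_of_minorization hHc hcpt hCstar h34 h2 hH0 h36 hϑ0 hϑ1 ms hinv

end Holds

/-- **Cuneo–Eckmann–Hairer–Rey-Bellet 2018, Theorem 2.13 for the purely quartic chain — the named
fact `CuneoEckmannHairerReyBellet2018_thm213_pureQuartic` HOLDS.** Printed (EJP 23 (2018) no. 55,
Thm 2.13): under C1–C5 "(1) The process (2.2) admits a unique invariant measure, and it has a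
smooth density with respect to Lebesgue measure. (2) For all `0 < θ < 1/T_max` … `∫ e^{θH} dμ < ∞`.
(3) For all `0 < θ < 1/T_max` there exist `C, c > 0` such that `|E_z f(z_t) - μ(f)| ≤ C e^{θH(z)} e^{-ct}`
for all `|f| ≤ e^{θH}`", for the chain `⟨μq⁴/4, r⁴/4, γ⟩`, `μ, γ > 0`, `N ≥ 1`, `T_L, T_R > 0`
(C1–C5 hold: Rem. 2.2 with `c₃ = 0`; Def. 2.4 / Ex. 2.5, `‖x‖⁴` is non-degenerate; Rem. 2.10).
Witness: the transition semigroup of the SDE (2.2) (`OscillatorChain.IsConfining.semigroup`);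
ergodic part `pureQuarticChain_langevin_semigroup_ergodic`; the smooth density of every invariant
probability measure is `pureQuarticChain_hasSmoothDensity_of_isInvariant` (Dynkin ⟹ weak
stationarity; Prop. 3.2 / Prop. 4.1 with Hörmander's Theorem 1.1, proved in the tree). The whole
printed proof is thereby carried out in the tree without any named-fact hypothesis.
[cite: CuneoEckmannHairerReyBellet2018, Thm 2.13] [cite: Hormander1967, Thm 1.1]
[cite: HairerMattingly2011, Thm 1.2] -/
theorem CuneoEckmannHairerReyBellet2018_thm213_pureQuartic_holds :
    CuneoEckmannHairerReyBellet2018_thm213_pureQuartic := by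
  intro μ γ hμ hγ N T_L T_R hN hL hR
  obtain ⟨huniq, ms, hms, hinv, hrest⟩ := pureQuarticChain_langevin_semigroup_ergodic hμ hγ hN hL hR
  refine ⟨(pureQuarticChain_isConfining hμ hγ.le).semigroup N T_L T_R hN hL.le hR.le, huniq,
    fun m hm hmi => ?_, ms, hms, hinv, hrest⟩
  haveI := hm
  exact pureQuarticChain_hasSmoothDensity_of_isInvariant μ hγ hN hL hR.le _ m hmi

end Literature.MathematicalPhysics.KineticTheory.HeatConduction
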